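import Summits.BirchSwinnertonDyer.BirchSwinnertonDyer.Theorems.GenusKolyvaginAtTwoPowDvdShaCardAtTwoRTGenusIndexDescentAlgebra
import HarnessLib

/-!
# Route `GenusKolyvaginAtTwo`, LINE 18 v4 (L_T `PowDvdShaCardAtTwoRT`, stmt-BirchSwinnertonDyer-23242),
# registered stub K `stub_genusIndexLaw` — factor (R), part 2: THE REGULATOR RATIO OF A RANK-ONE QUADRATIC BASE
# CHANGE `Reg(E/ℚ) · Reg(E^{(d_K)}/ℚ) = Reg(E_K/K) / 2`

Seat `bsd-line-gk2-p2` g14 (cell `bsd-f1-sign2`), `--supports stmt-BirchSwinnertonDyer-23242` (helper; closes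
nothing).  THEOREMS ONLY (no definition, no named fact, no `sorry`); UNCONDITIONAL; BSD is not proved by any of
this.  Part 2 of 2 (part 1 = `…GenusIndexDescentAlgebra.lean`: involution descent with odd torsion, one-point
Mordell–Weil bases, `heightPairing_congrEquiv`).

The pen's stub K (`plus_descent.lean` v4, 2026-08-28T23:12Z) asks for the 2-adic value of the Ш-free ratio
`ρ = B(W)·B(Wd)/B(W_K)`, `B = Reg·Ω·C/#tors²`, on the genus frame; its bullet (R) is the regulator factor:
"`E(K) ⊇ E(ℚ) + E^{d_K}(ℚ)` with 2-power index `a`, and `a = 1` here (rank `= 1`, the rank-0 summand is odd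
torsion) ⇒ `Reg(W)·Reg(Wd)/Reg(W_K) = 1/2`" (heights over `K` are `K`-relative, tree
`canonicalHeight_baseChange`: `ĥ_K = [K:ℚ]·ĥ_ℚ`).  This file proves exactly that, for ANY elliptic `W/ℚ`
and ANY quadratic number field `K` with `rank E(K) = 1` and `E(K)[2] = 0`:

* `heightPairing_twistMap` / `heightPairing_incl`: `⟨τR, τR⟩_K = 2⟨R, R⟩_ℚ`, `⟨ιR, ιR⟩_K = 2⟨R, R⟩_ℚ`
  (Silverman VIII.5.4(b) + VIII.9.1; `τ` = `QuadraticDescent.twistMap`, base change followed by `u = θ`);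
* **`regulator_mul_regulator_quadraticTwist_eq_half`**: `[K:ℚ] = 2`, `rank_ℤ E(K) = 1`, `E(K)[2] = 0` ⇒
  `Reg(W)·Reg(W^{(d_K)}) = Reg(W_K)/2`; by Silverman Exercise 10.16 (tree `QuadraticTwistRank`) exactly
  one of `E(ℚ)`, `E^{(d_K)}(ℚ)` has rank one, its generator `R` gives the Mordell–Weil basis `{ι R}` resp.
  `{τ R}` of `E(K)` (part 1: the other summand is ODD torsion, so the index `[E(K) : E(ℚ) + E^{d_K}(ℚ)]` is
  odd), and `⟨·,·⟩_K = 2⟨·,·⟩_ℚ`; the rank-0 factor is `1` (`regulator_eq_one_of_rank_zero`);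
* `regulator_mul_regulator_eq_half_of_twist`: the same for ANY model `Wd = C • W^{(d_K)}`
  (`regulator_variableChange_holds`).

References: [SilvermanAEC2009] VIII.5.4(b), VIII.9 (Thm. 9.3, definition of `R_{E/K}`), Exercise 10.16;
[Kramer1981] Thm. 1 (the index `[E(K) : E(ℚ) + E^{D}(ℚ)]`); [GrossZagier1986] V.§2 (p. 313: `ĥ_K = 2ĥ_ℚ`);
[DokchitserDokchitserAnnals2010] Conj. 2.1 (the `K`-relative regulator in the BSD quotient).
-/

set_option autoImplicit false
-- the Theorems namespace of this sub repeats the summit name by design (D-0017 nested layout)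
set_option linter.dupNamespace false

noncomputable section

open scoped Classical

namespace Summit.BirchSwinnertonDyer.BirchSwinnertonDyer.Theorems.GenusExact.PlusDescent

open WeierstrassCurve WeierstrassCurve.QuadraticDescent Module
  Literature.NumberTheory.QuadraticFields

/-! ## §3 The regulator ratio of a rank-one quadratic base change -/

section Main

variable (W : WeierstrassCurve ℚ) [W.IsElliptic] (K : Type) [Field K] [NumberField K]

/-- **The pairing along the twisting map**: for `K = ℚ(θ)`, `θ² = c`, and `R ∈ E^{(c)}(ℚ)`,
`⟨τR, τR⟩_K = 2·⟨R, R⟩_ℚ` on the completed-square model over `K` — `τ` is base change to `K` followed by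
the change of variables `u = θ` (`QuadraticDescent.twistMap`), heights multiply by `[K:ℚ] = 2` under base
change (`heightPairing_baseChange`, Silverman VIII.5.4(b)) and are invariant under changes of variables
(`heightPairing_pointEquiv`, VIII.9.1). [cite: SilvermanAEC2009, Prop. VIII.5.4(b) and VIII.9.1] -/
theorem heightPairing_twistMap (h2 : finrank ℚ K = 2) {θ : K} {c : ℚ}
    (hθ : θ ∉ Set.range (algebraMap ℚ K)) (hc : θ ^ 2 = algebraMap ℚ K c)
    (R : (W.quadraticTwist c).toAffine.Point) :
    Affine.Point.heightPairing (twistMap W hθ hc R) (twistMap W hθ hc R) =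
      2 * Affine.Point.heightPairing R R := by
  haveI := W.isElliptic_quadraticTwist (Quadratic.sq_ne_zero_of_not_mem_range hθ hc)
  have hτ : twistMap W hθ hc R = Affine.Point.congrEquiv (twistUntwist_smul_baseChange W hθ hc)
      (VariableChange.pointEquiv ((W.quadraticTwist c).baseChange K) (twistUntwist hθ)
        (incl K (W.quadraticTwist c) R)) := rfl
  rw [hτ, heightPairing_congrEquiv, Affine.Point.heightPairing_pointEquiv]
  have h := Affine.Point.heightPairing_baseChange (W := W.quadraticTwist c) (K := ℚ) (L := K) R R
  rw [h2] at h
  push_cast at h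
  convert h using 2 <;> rfl

/-- **The pairing along the inclusion**: `⟨ιR, ιR⟩_K = 2·⟨R, R⟩_ℚ`.
[cite: SilvermanAEC2009, Prop. VIII.5.4(b)] -/
theorem heightPairing_incl (h2 : finrank ℚ K = 2) (V : WeierstrassCurve ℚ) [V.IsElliptic]
    (R : V.toAffine.Point) :
    Affine.Point.heightPairing (incl K V R) (incl K V R) = 2 * Affine.Point.heightPairing R R := by
  have h := Affine.Point.heightPairing_baseChange (W := V) (K := ℚ) (L := K) R R
  rw [h2] at h
  push_cast at h
  convert h using 2 <;> rfl

/-- A square-root generator of a quadratic number field with square EXACTLY the discriminant: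
`K = ℚ(θ)`, `θ² = d_K` (from any generator `√c`, `d_K = c q²`, take `θ = q√c`). [folklore] -/
theorem exists_not_mem_range_sq_eq_discr (h2 : finrank ℚ K = 2) :
    ∃ θ : K, θ ∉ Set.range (algebraMap ℚ K) ∧ θ ^ 2 = algebraMap ℚ K (NumberField.discr K : ℚ) := by
  obtain ⟨θ₀, c₀, hθ₀, hc₀⟩ := Quadratic.exists_sq_eq_algebraMap (F := ℚ) (K := K) h2
  obtain ⟨q, hq, hdq⟩ := NumberField.exists_discr_eq_mul_sq h2 hθ₀ hc₀
  refine ⟨algebraMap ℚ K q * θ₀, ?_, ?_⟩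
  · rintro ⟨r, hr⟩
    apply hθ₀
    refine ⟨r / q, ?_⟩
    have hq' : algebraMap ℚ K q ≠ 0 := (map_ne_zero _).mpr hq
    rw [map_div₀, hr]
    field_simp
  · rw [mul_pow, hc₀, ← map_pow, ← map_mul, hdq, mul_comm]

omit [W.IsElliptic] in
/-- **`E^{(d_K)}(ℚ)[2] = 0` from `E(K)[2] = 0`**: the twisting map `τ : E^{(d_K)}(ℚ) → E(K)` (to the
completed-square model, `QuadraticDescent.twistMap`) is an injective homomorphism.  (The implicit binder
`hdec` lets the statement match any `DecidableEq ℚ` instance at the call site.) [cite: SilvermanAEC2009, X.5 Cor. 5.4] -/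
theorem forall_two_nsmul_eq_zero_quadraticTwist_discr {hdec : DecidableEq ℚ} (h2 : finrank ℚ K = 2)
    (htors : ∀ P : (W.baseChange K).toAffine.Point, 2 • P = 0 → P = 0)
    (P : (W.quadraticTwist (NumberField.discr K : ℚ)).toAffine.Point) (hP : 2 • P = 0) : P = 0 := by
  -- the statement is elaborated against an arbitrary decidability instance on `ℚ` (so that it applies under
  -- `instDecidableEqRat`); the generic-field lemmas carry the classical one: identify them (subsingleton)
  obtain rfl : hdec = fun a b => Classical.propDecidable (a = b) := Subsingleton.elim _ _
  letI hdec' : DecidableEq ℚ := fun a b => Classical.propDecidable (a = b)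
  obtain ⟨θ, hθ, hc⟩ := exists_not_mem_range_sq_eq_discr K h2
  obtain ⟨C, hC⟩ := W.exists_variableChange_quadraticTwist_one
  have hCK : C.map (algebraMap ℚ K) • W.baseChange K = (W.quadraticTwist 1).baseChange K := by
    rw [baseChange, baseChange, map_variableChange, hC]
  have htorsVK : ∀ Q : ((W.quadraticTwist 1).baseChange K).toAffine.Point, 2 • Q = 0 → Q = 0 := by
    intro Q hQ
    set e := (VariableChange.pointEquiv (W.baseChange K) (C.map (algebraMap ℚ K))).trans
      (Affine.Point.congrEquiv hCK) with he
    have h := htors (e.symm Q) (by rw [← map_nsmul, hQ, map_zero])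
    simpa using congrArg e h
  exact forall_two_nsmul_eq_zero_of_injective (twistMap W hθ hc) (twistMap_injective W hθ hc) htorsVK P hP

/-- **THE REGULATOR RATIO (factor (R) of stub K `stub_genusIndexLaw`, LINE 18 v4).**  For `W/ℚ` elliptic and
a quadratic number field `K` (`[K:ℚ] = 2`, `d_K = NumberField.discr K`) with `rank_ℤ E(K) = 1` and
`E(K)[2] = 0`: **`Reg(W) · Reg(W^{(d_K)}) = Reg(W_K) / 2`**.  Proof: `rank E(ℚ) + rank E^{(d_K)}(ℚ) = 1`
(Silverman Exercise 10.16, tree `mordellWeilRank_add_eq_of_baseChange`); if `E^{(d_K)}(ℚ)` (resp. `E(ℚ)`)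
has the rank with Mordell–Weil generator `R`, then `{τR}` (resp. `{ιR}`) is a Mordell–Weil basis of `E(K)` —
the other summand is torsion of ODD order since `E(K)[2] = 0`, so it is `2`-divisible and the index
`[E(K) : E(ℚ) + E^{(d_K)}(ℚ)]` is prime to `2` (§1) — and `⟨τR, τR⟩_K = 2⟨R, R⟩_ℚ` (resp. for `ι`); the
rank-0 regulator is `1`.  Everything is transported along the completed-square model `W^{(1)}`
(`regulator_variableChange_holds`).  UNCONDITIONAL.
[cite: SilvermanAEC2009, Exercise 10.16, Prop. VIII.5.4(b), VIII.9 (definition of R_{E/K})]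
[cite: Kramer1981, Thm. 1] [cite: GrossZagier1986, V.§2 (p. 313)] -/
theorem regulator_mul_regulator_quadraticTwist_eq_half (h2 : finrank ℚ K = 2)
    (hrank : (W.baseChange K).mordellWeilRank = 1)
    (htors : ∀ P : (W.baseChange K).toAffine.Point, 2 • P = 0 → P = 0) :
    W.regulator * (W.quadraticTwist (NumberField.discr K : ℚ)).regulator =
      (W.baseChange K).regulator / 2 := by
  -- pin the decidability instance on `ℚ` to the classical one carried by the generic-field lemmas
  letI hdec : DecidableEq ℚ := fun a b => Classical.propDecidable (a = b)
  haveI hWK : (W.baseChange K).IsElliptic := by rw [baseChange]; infer_instance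
  have hd0 : (NumberField.discr K : ℚ) ≠ 0 := by exact_mod_cast NumberField.discr_ne_zero K
  haveI := W.isElliptic_quadraticTwist hd0
  -- a square-root generator with `θ² = d_K`
  set d : ℚ := (NumberField.discr K : ℚ) with hd
  obtain ⟨θ, hθ, hc⟩ := exists_not_mem_range_sq_eq_discr K h2
  -- the completed-square model `V = W^{(1)}` and its base change
  obtain ⟨C, hC⟩ := W.exists_variableChange_quadraticTwist_one
  set V := W.quadraticTwist 1 with hV
  haveI hV1 : V.IsElliptic := W.isElliptic_quadraticTwist one_ne_zero
  haveI hVK : (V.baseChange K).IsElliptic := by rw [baseChange]; infer_instance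
  have hCK : C.map (algebraMap ℚ K) • W.baseChange K = V.baseChange K := by
    rw [baseChange, baseChange, map_variableChange, hC]
  have hregV : V.regulator = W.regulator := by
    rw [← hC]; exact regulator_variableChange_holds W C
  have hregVK : (V.baseChange K).regulator = (W.baseChange K).regulator := by
    rw [← hCK]; exact regulator_variableChange_holds (W.baseChange K) (C.map (algebraMap ℚ K))
  have hrankV : V.mordellWeilRank = W.mordellWeilRank := by
    rw [← hC]; exact mordellWeilRank_variableChange_holds W C
  -- no `2`-torsion on `V(K)`, `V(ℚ)`, `W^{(d)}(ℚ)`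
  have htorsVK : ∀ P : (V.baseChange K).toAffine.Point, 2 • P = 0 → P = 0 := by
    intro P hP
    set e := (VariableChange.pointEquiv (W.baseChange K) (C.map (algebraMap ℚ K))).trans
      (Affine.Point.congrEquiv hCK) with he
    have h := htors (e.symm P) (by rw [← map_nsmul, hP, map_zero])
    simpa using congrArg e h
  -- the conjugation and the two maps
  set σ := Quadratic.conj h2 hθ hc with hσdef
  have hσθ : σ θ = -θ := Quadratic.conj_gen h2 hθ hc
  have hσσ : ∀ z, σ (σ z) = z := Quadratic.conj_conj h2 hθ hc
  set ιₘ := incl K V with hι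
  set τₘ := twistMap W hθ hc with hτ
  set σₘ := conjMap V σ with hσₘ
  have hσσₘ : ∀ x, σₘ (σₘ x) = x := conjMap_conjMap V hσσ
  have hσι : ∀ a, σₘ (ιₘ a) = ιₘ a := conjMap_incl V σ
  have hστ : ∀ b, σₘ (τₘ b) = -τₘ b := conjMap_twistMap W hθ hc hσθ
  have hfix : ∀ P : (V.baseChange K).toAffine.Point, σₘ P = P → P ∈ ιₘ.range := by
    rintro (_ | ⟨x, y, h⟩) hP
    · exact ⟨0, (map_zero ιₘ).trans Affine.Point.zero_def⟩
    · rw [hσₘ, Affine.Point.map_some, Affine.Point.some.injEq] at hP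
      obtain ⟨a, ha⟩ := Quadratic.exists_eq_algebraMap_of_conj_eq h2 hθ hc hP.1
      obtain ⟨b, hb⟩ := Quadratic.exists_eq_algebraMap_of_conj_eq h2 hθ hc hP.2
      obtain ⟨Q, hQ⟩ := exists_incl_eq V h ha.symm hb.symm
      exact ⟨Q, hQ⟩
  have hanti : ∀ P : (V.baseChange K).toAffine.Point, σₘ P = -P → P ∈ τₘ.range := by
    rintro (_ | ⟨x, y, h⟩) hP
    · exact ⟨0, (map_zero τₘ).trans Affine.Point.zero_def⟩
    · rw [hσₘ, Affine.Point.map_some, Affine.Point.neg_some, Affine.Point.some.injEq,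
        negY_quadraticTwist_one_baseChange] at hP
      obtain ⟨a, ha⟩ := Quadratic.exists_eq_algebraMap_of_conj_eq h2 hθ hc hP.1
      obtain ⟨b, hb⟩ := Quadratic.exists_eq_mul_of_conj_eq_neg h2 hθ hc hP.2
      obtain ⟨R, hR⟩ := exists_twistMap_eq W hθ hc h ha.symm hb.symm
      exact ⟨R, hR⟩
  have hτinj : Function.Injective τₘ := twistMap_injective W hθ hc
  have hιinj : Function.Injective ιₘ := incl_injective V
  have htorsV : ∀ P : V.toAffine.Point, 2 • P = 0 → P = 0 :=
    forall_two_nsmul_eq_zero_of_injective ιₘ hιinj htorsVK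
  have htorsD : ∀ P : (W.quadraticTwist d).toAffine.Point, 2 • P = 0 → P = 0 :=
    forall_two_nsmul_eq_zero_of_injective τₘ hτinj htorsVK
  -- the ranks: `rank V(ℚ) + rank W^{(d)}(ℚ) = 1`
  have hsum : W.mordellWeilRank + (W.quadraticTwist d).mordellWeilRank = 1 :=
    W.mordellWeilRank_add_eq_of_baseChange K h2 one_ne_zero hrank
  -- the regulator of `V(K)` from a one-point Mordell–Weil basis
  have hregK : ∀ g : (V.baseChange K).toAffine.Point, IsMordellWeilBasis ![g] →
      (V.baseChange K).regulator = Affine.Point.heightPairing g g := by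
    intro g hg
    rw [← hg.regulatorOf_eq_regulator, regulatorOf_fin_one]
    rfl
  rcases Nat.eq_zero_or_pos W.mordellWeilRank with hW0 | hWpos
  · -- `rank E(ℚ) = 0`, `rank E^{(d)}(ℚ) = 1`: basis `{τ R}`
    have hD1 : (W.quadraticTwist d).mordellWeilRank = 1 := by omega
    obtain ⟨R, hP⟩ := exists_isMordellWeilBasis_single (W.quadraticTwist d) hD1
    obtain ⟨hR0, hRsp⟩ := (isMordellWeilBasis_single_iff R).mp hP
    have hA : ∀ a : V.toAffine.Point, IsOfFinAddOrder a :=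
      forall_isOfFinAddOrder_of_mordellWeilRank_eq_zero V (hrankV.trans hW0)
    have hsp := exists_zsmul_sub_mem_torsion_of_fixed_torsion ιₘ τₘ σₘ hσσₘ hσι hfix hanti htorsVK hA R
      hRsp
    have hg : IsMordellWeilBasis ![τₘ R] := by
      refine (isMordellWeilBasis_single_iff _).mpr ⟨?_, hsp⟩
      intro hmem
      apply hR0
      rw [AddCommGroup.mem_torsion] at hmem ⊢
      exact (hτinj.isOfFinAddOrder_iff (f := τₘ)).mp hmem
    have hregD : (W.quadraticTwist d).regulator = Affine.Point.heightPairing R R := by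
      rw [← hP.regulatorOf_eq_regulator, regulatorOf_fin_one]
      rfl
    rw [← hregVK, hregK _ hg, hτ, heightPairing_twistMap W K h2 hθ hc, ← hregD,
      W.regulator_eq_one_of_rank_zero hW0]
    ring
  · -- `rank E(ℚ) = 1`, `rank E^{(d)}(ℚ) = 0`: basis `{ι R}`
    have hW1 : W.mordellWeilRank = 1 := by omega
    have hD0 : (W.quadraticTwist d).mordellWeilRank = 0 := by omega
    have hV1' : V.mordellWeilRank = 1 := hrankV.trans hW1
    obtain ⟨R, hP⟩ := exists_isMordellWeilBasis_single V hV1'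
    obtain ⟨hR0, hRsp⟩ := (isMordellWeilBasis_single_iff R).mp hP
    have hB : ∀ b : (W.quadraticTwist d).toAffine.Point, IsOfFinAddOrder b :=
      forall_isOfFinAddOrder_of_mordellWeilRank_eq_zero _ hD0
    have hsp := exists_zsmul_sub_mem_torsion_of_antifixed_torsion ιₘ τₘ σₘ hσσₘ hστ hfix hanti htorsVK hB R
      hRsp
    have hg : IsMordellWeilBasis ![ιₘ R] := by
      refine (isMordellWeilBasis_single_iff _).mpr ⟨?_, hsp⟩
      intro hmem
      apply hR0
      rw [AddCommGroup.mem_torsion] at hmem ⊢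
      exact (hιinj.isOfFinAddOrder_iff (f := ιₘ)).mp hmem
    have hregV1 : V.regulator = Affine.Point.heightPairing R R := by
      rw [← hP.regulatorOf_eq_regulator, regulatorOf_fin_one]
      rfl
    rw [← hregVK, hregK _ hg, hι, heightPairing_incl K h2 V R, ← hregV1, hregV,
      (W.quadraticTwist d).regulator_eq_one_of_rank_zero hD0]
    ring

/-! ## §4 Any model of the twist -/

/-- **Factor (R) for any model `Wd` of `E^{(d_K)}`** (e.g. the globally minimal one of stub K): for `W/ℚ`
elliptic, `K` quadratic with `rank_ℤ E(K) = 1` and `E(K)[2] = 0`, and `C • W^{(d_K)} = Wd`: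
`Reg(W) · Reg(Wd) = Reg(W_K) / 2` (the regulator is a change-of-variables invariant,
`regulator_variableChange_holds`). UNCONDITIONAL. [cite: SilvermanAEC2009, Exercise 10.16 and VIII.9] -/
theorem regulator_mul_regulator_eq_half_of_twist (h2 : finrank ℚ K = 2)
    (hrank : (W.baseChange K).mordellWeilRank = 1)
    (htors : ∀ P : (W.baseChange K).toAffine.Point, 2 • P = 0 → P = 0)
    (Wd : WeierstrassCurve ℚ) [Wd.IsElliptic] {C : VariableChange ℚ}
    (hC : C • W.quadraticTwist (NumberField.discr K : ℚ) = Wd) :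
    W.regulator * Wd.regulator = (W.baseChange K).regulator / 2 := by
  have hd0 : (NumberField.discr K : ℚ) ≠ 0 := by exact_mod_cast NumberField.discr_ne_zero K
  haveI := W.isElliptic_quadraticTwist hd0
  have hreg : Wd.regulator = (W.quadraticTwist (NumberField.discr K : ℚ)).regulator := by
    rw [← hC]; exact regulator_variableChange_holds _ C
  rw [hreg]
  exact regulator_mul_regulator_quadraticTwist_eq_half W K h2 hrank htors

end Main

end Summit.BirchSwinnertonDyer.BirchSwinnertonDyer.Theorems.GenusExact.PlusDescent

end
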